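/-
Copyright (c) 2026 the pub-hodgecm-mathlib formalisation cell (harness21).  Prover seat hodgecm-mathlib-K2Liu-p10 (g4), Track B «K2-LIT»,
#184♮ = hLiu418 = `stmt-HodgeConjecture-24832`; (σ) endgame organ, SMALL SIDE, S-2c part (b): the Levi slice letter `hS0` for the twisted Kudla–Rallis frame.  KERNEL: theorems only.
-/
import Summits.HodgeConjecture.HodgeConjecture.Theorems.K2LiuKRFrameComponents   -- ★ S-1 part 2a (`krFrameTw_apply_eq`, `wittMatrix_krFrameTw_symm`; brings S-0a, I-0 `leviAct`)
import HarnessLib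

/-!
# Crux `HLiu418`, (σ) small side, S-2c part (b): A LEVI ELEMENT `D ⊗ 1` (ACTING ON THE `𝕍`-INDEX OF THE WITT MATRIX) PRESERVES THE SLICE `u = 0` OF THE TWISTED KUDLA–RALLIS FRAME,
# ACTING ON THE INTEGRATED BLOCK BY `leviAct_n D`  — the letter `hS0` of ★ S-2a ∕ S-2b

Cell `hodgecm-mathlib`, crux item hLiu418 = `stmt-HodgeConjecture-24832`, route of record `HCCMUnconditional`; squad K2 ∕ K2Liu, prover K2Liu-p10 (g4).
THEOREMS ONLY; lane `--supports stmt-HodgeConjecture-24832 --as helper`.  D10 currency of ★ I-0 ∕ S-0a: `(F E c hcδ hδ v n) (eV : Fin n × Fin 3 ≃ Fin n₃) (P) (A)`.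

V8e's Levi pin `aX m` is (★ I-2 `leviRhoLoc`) `leviAct_{n₃} G` with `G = reindex eV (D ⊗ₖ 1)` (`D = blkD (matA m) ∈ GL_n(E ⊗ F_v)`, ★ `val_leviBlkD`): on the Witt matrix `Y` of a point it is
LEFT multiplication `Y ↦ D·Y` on the `𝕍`-index, which commutes with the Witt column mix `colMix P` (acting on the `V′`-index).  Hence:
* §1 `matOfVec_reindex_kronecker_one_mulVec` (`(D ⊗ 1)·b` read as a matrix is `D·B`), `colMix_rowMix` (row and column operations commute);
* §2 **`krFrameTw_leviAct_symm_slice`** (= `hS0`): for `G` with `G.val = reindex eV eV (D.val ⊗ₖ 1)`,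
  `θ ((leviAct G)⁻¹ (θ⁻¹((0 ⊔ 0) ⊔ t))) = (0 ⊔ 0) ⊔ (leviAct_n D⁻¹ t)` for `θ = krFrameTw eV P A`, and its MATRIX form **`krFrameTw_leviAct_symm_slice_mulVec`** with
  `D_m := LinearMap.toMatrix' (leviAct_n D⁻¹)` (the shape ★ S-2a `krFun_zero_leviOp` ∕ S-2b `krSection_levi_mul` consume).

HONEST LABEL: HC_CM is proved only modulo the 7 printed citations (2 remaining named inputs: hLiu418 = stmt-HodgeConjecture-24832, h413 = stmt-HodgeConjecture-24833)
until rung 0 closes; helper, closes no item.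
References: [KudlaRallis1994] §1; [Kudla1994] §3 (the Siegel Levi on the mixed model); [MoeglinVignerasWaldspurger1987] Chap. 2 II.6.
-/

set_option autoImplicit false
set_option linter.dupNamespace false -- the mandated namespace repeats `HodgeConjecture.HodgeConjecture`

noncomputable section

open scoped Matrix Kronecker
open NumberField IsDedekindDomain Matrix
open Literature.NumberTheory.Automorphic Literature.NumberTheory.Automorphic.UnitaryGroup
open Summit.HodgeConjecture.HodgeConjecture.Cruxes.HLiu418.K2LiuDeltaModelRealFrame
open Summit.HodgeConjecture.HodgeConjecture.Cruxes.HLiu418.K2LiuKRFrameDefs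
open Summit.HodgeConjecture.HodgeConjecture.Cruxes.HLiu418.K2LiuKRFrameComponents

namespace Summit.HodgeConjecture.HodgeConjecture.Cruxes.HLiu418.K2LiuKRFrameLeviSlice

variable (F : Type) [Field F] [NumberField F] (E : Type) [Field E] [NumberField E] [Algebra F E]
  [Algebra.IsQuadraticExtension F E] (c : E ≃ₐ[F] E)
  {δ : E} (hcδ : c δ = -δ) (hδ : δ ≠ 0) (v : HeightOneSpectrum (𝓞 F)) (n : ℕ) {n₃ : ℕ} (eV : Fin n × Fin 3 ≃ Fin n₃)
  (P : GL (Fin 3) (LocalRing E v)) (A : (Fin (n + n) → v.adicCompletion F) ≃ₗ[v.adicCompletion F] (Fin (n + n) → v.adicCompletion F))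

/-! ## §1 Row operations on the Witt matrix -/

omit [Algebra.IsQuadraticExtension F E] in
/-- `(D ⊗ 1)·b`, read as an `n × 3` matrix, is `D·B`. [cite: Kudla1994, §3] -/
theorem matOfVec_reindex_kronecker_one_mulVec (D : Matrix (Fin n) (Fin n) (LocalRing E v)) (b : Fin n₃ → LocalRing E v) (i : Fin n) (k : Fin 3) :
    matOfVec F E v n eV (Matrix.reindex eV eV (D ⊗ₖ (1 : Matrix (Fin 3) (Fin 3) (LocalRing E v))) *ᵥ b) i k =
      ∑ j, D i j * matOfVec F E v n eV b j k := by
  rw [K2LiuKRFrameDefs.matOfVec_apply, Matrix.mulVec, dotProduct]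
  simp only [K2LiuKRFrameDefs.matOfVec_apply]
  rw [← Equiv.sum_comp eV, Fintype.sum_prod_type]
  refine Finset.sum_congr rfl fun j _ => ?_
  rw [Finset.sum_eq_single k]
  · simp [Matrix.reindex_apply, Matrix.submatrix_apply, Matrix.kroneckerMap_apply, Matrix.one_apply_eq]
  · intro k' _ hk'
    simp [Matrix.reindex_apply, Matrix.submatrix_apply, Matrix.kroneckerMap_apply, Matrix.one_apply_ne' hk']
  · intro h; exact absurd (Finset.mem_univ k) h

omit [Algebra.IsQuadraticExtension F E] in
/-- row operations (on the `𝕍`-index) commute with the Witt column mix (on the `V′`-index). [cite: KudlaRallis1994, §1] -/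
theorem colMix_rowMix (D : Matrix (Fin n) (Fin n) (LocalRing E v)) (X : Fin n → Fin 3 → LocalRing E v) :
    colMix F E v n P (fun i k => ∑ j, D i j * X j k) = fun i k => ∑ j, D i j * colMix F E v n P X j k := by
  funext i k
  simp only [colMix_apply, Matrix.mulVec, dotProduct, Finset.mul_sum]
  rw [Finset.sum_comm]
  refine Finset.sum_congr rfl fun j _ => Finset.sum_congr rfl fun l _ => ?_
  ring

/-! ## §2 The Levi slice letter -/

/-- **`hS0` FOR THE TWISTED KUDLA–RALLIS FRAME**: a Levi element `G = D ⊗ 1` maps the slice point `θ⁻¹((0 ⊔ 0) ⊔ t)` (Witt columns `(R⁻¹t, 0, 0)`) to the slice point with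
Witt columns `(D⁻¹R⁻¹t, 0, 0)`, i.e. `θ (leviAct G⁻¹ (θ⁻¹((0 ⊔ 0) ⊔ t))) = (0 ⊔ 0) ⊔ (leviAct_n D⁻¹ t)`. [cite: KudlaRallis1994, §1] [cite: Kudla1994, §3] -/
theorem krFrameTw_leviAct_inv_slice (G : GL (Fin n₃) (LocalRing E v)) (D : GL (Fin n) (LocalRing E v))
    (hG : G⁻¹.val = Matrix.reindex eV eV (D⁻¹.val ⊗ₖ (1 : Matrix (Fin 3) (Fin 3) (LocalRing E v)))) (t : Fin (n + n) → v.adicCompletion F) :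
    krFrameTw F E c hcδ hδ v n eV P A (leviAct F E c hcδ hδ v n₃ G⁻¹ ((krFrameTw F E c hcδ hδ v n eV P A).symm (Sum.elim (Sum.elim (0 : Fin (n + n) → v.adicCompletion F) (0 : Fin (n + n) → v.adicCompletion F)) t))) =
      Sum.elim (Sum.elim (0 : Fin (n + n) → v.adicCompletion F) (0 : Fin (n + n) → v.adicCompletion F)) (leviAct F E c hcδ hδ v n D⁻¹ t) := by
  rw [krFrameTw_apply_eq, leviAct_apply, LinearEquiv.symm_apply_apply, hG]
  -- the Witt matrix of the moved point: rows mixed by `D⁻¹`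
  have hW : colMix F E v n P (matOfVec F E v n eV (Matrix.reindex eV eV (D⁻¹.val ⊗ₖ (1 : Matrix (Fin 3) (Fin 3) (LocalRing E v))) *ᵥ
      (reFrame F E c hcδ hδ v n₃).symm ((krFrameTw F E c hcδ hδ v n eV P A).symm (Sum.elim (Sum.elim (0 : Fin (n + n) → v.adicCompletion F) (0 : Fin (n + n) → v.adicCompletion F)) t)))) =
      fun i k => ∑ j, D⁻¹.val i j * colMix F E v n P (matOfVec F E v n eV ((reFrame F E c hcδ hδ v n₃).symm
        ((krFrameTw F E c hcδ hδ v n eV P A).symm (Sum.elim (Sum.elim (0 : Fin (n + n) → v.adicCompletion F) (0 : Fin (n + n) → v.adicCompletion F)) t)))) j k := by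
    rw [← colMix_rowMix]
    congr 1
    funext i k
    exact matOfVec_reindex_kronecker_one_mulVec F E v n eV D⁻¹.val _ i k
  -- the three columns of the old Witt matrix: `(R⁻¹ t, 0, 0)`
  have hcols := fun i => wittMatrix_krFrameTw_symm_slice F E c hcδ hδ v n eV P A (0 : Fin (n + n) → v.adicCompletion F) t i
  have hc0 : (fun i => colMix F E v n P (matOfVec F E v n eV (Matrix.reindex eV eV (D⁻¹.val ⊗ₖ (1 : Matrix (Fin 3) (Fin 3) (LocalRing E v))) *ᵥ
      (reFrame F E c hcδ hδ v n₃).symm ((krFrameTw F E c hcδ hδ v n eV P A).symm (Sum.elim (Sum.elim (0 : Fin (n + n) → v.adicCompletion F) (0 : Fin (n + n) → v.adicCompletion F)) t)))) i 0) =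
      D⁻¹.val *ᵥ (reFrame F E c hcδ hδ v n).symm t := by
    funext i
    rw [hW]
    simp only [Matrix.mulVec, dotProduct]
    exact Finset.sum_congr rfl fun j _ => by rw [(hcols j).1]
  have hc1 : (fun i => colMix F E v n P (matOfVec F E v n eV (Matrix.reindex eV eV (D⁻¹.val ⊗ₖ (1 : Matrix (Fin 3) (Fin 3) (LocalRing E v))) *ᵥ
      (reFrame F E c hcδ hδ v n₃).symm ((krFrameTw F E c hcδ hδ v n eV P A).symm (Sum.elim (Sum.elim (0 : Fin (n + n) → v.adicCompletion F) (0 : Fin (n + n) → v.adicCompletion F)) t)))) i 1) = 0 := by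
    funext i
    rw [hW]
    simp only [Pi.zero_apply]
    exact Finset.sum_eq_zero fun j _ => by rw [(hcols j).2.1, mul_zero]
  have hc2 : (fun i => colMix F E v n P (matOfVec F E v n eV (Matrix.reindex eV eV (D⁻¹.val ⊗ₖ (1 : Matrix (Fin 3) (Fin 3) (LocalRing E v))) *ᵥ
      (reFrame F E c hcδ hδ v n₃).symm ((krFrameTw F E c hcδ hδ v n eV P A).symm (Sum.elim (Sum.elim (0 : Fin (n + n) → v.adicCompletion F) (0 : Fin (n + n) → v.adicCompletion F)) t)))) i 2) = 0 := by
    funext i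
    rw [hW]
    simp only [Pi.zero_apply]
    exact Finset.sum_eq_zero fun j _ => by rw [(hcols j).2.2, map_zero, Pi.zero_apply, mul_zero]
  rw [hc0, hc1, hc2, map_zero, map_zero, ← leviAct_apply, sumGlue_apply]

/-- the same with the integrated block written as a MATRIX action `D_m *ᵥ t`, `D_m := LinearMap.toMatrix' (leviAct_n D⁻¹)` (the shape of ★ S-2a∕S-2b's `hS0`).
[cite: KudlaRallis1994, §1] -/
theorem krFrameTw_leviAct_inv_slice_mulVec (G : GL (Fin n₃) (LocalRing E v)) (D : GL (Fin n) (LocalRing E v))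
    (hG : G⁻¹.val = Matrix.reindex eV eV (D⁻¹.val ⊗ₖ (1 : Matrix (Fin 3) (Fin 3) (LocalRing E v)))) (t : Fin (n + n) → v.adicCompletion F) :
    krFrameTw F E c hcδ hδ v n eV P A ((leviAct F E c hcδ hδ v n₃ G).symm ((krFrameTw F E c hcδ hδ v n eV P A).symm (Sum.elim (Sum.elim (0 : Fin (n + n) → v.adicCompletion F) (0 : Fin (n + n) → v.adicCompletion F)) t))) =
      Sum.elim (Sum.elim (0 : Fin (n + n) → v.adicCompletion F) (0 : Fin (n + n) → v.adicCompletion F)) (LinearMap.toMatrix' ((leviAct F E c hcδ hδ v n D⁻¹ : _ ≃ₗ[v.adicCompletion F] _) : _ →ₗ[v.adicCompletion F] _) *ᵥ t) := by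
  rw [LinearMap.toMatrix'_mulVec, show (leviAct F E c hcδ hδ v n₃ G).symm = leviAct F E c hcδ hδ v n₃ G⁻¹ by rw [map_inv]; rfl]
  exact krFrameTw_leviAct_inv_slice F E c hcδ hδ v n eV P A G D hG t

end Summit.HodgeConjecture.HodgeConjecture.Cruxes.HLiu418.K2LiuKRFrameLeviSlice

end
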